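import Literature.MathematicalPhysics.QuantumChemistry.SlaterDeterminantRDMs
import Literature.MathematicalPhysics.QuantumChemistry.OnePositivityFromTwoPositivity
import Literature.MathematicalPhysics.QuantumLattice.FrozenEnvironmentCompression
import HarnessLib

/-!
# Ventures/CertifiedQuantumChemistry — Rows/FrozenCoreRelaxationPair.lean: the frozen-core extension
# of an ABSTRACT pair `(γ, Γ)` of the variational 2-RDM programme (definitions, block entries, `D ⪰ 0`)

HONEST FRAMING (verbatim): certified bounds for a stated model Hamiltonian in a stated basis; not a
claim about the real molecule beyond that model.

Seat rdm-B (gen 22). `Literature/MathematicalPhysics/QuantumChemistry/FrozenCoreDensityMatrices.lean`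
computes the reduced density matrices of a frozen-core WAVE FUNCTION `V_K ψ` block by block from those of
its active part `ψ`. This file takes those block formulas as the DEFINITION of a linear-affine extension
map on ABSTRACT pairs — the objects of the variational 2-RDM (DQG) programme
(`VariationalRDMRelaxation.lean`: `IsDQGFeasible`, `qMap`, `gMap`) — along an order embedding
`e : ι ↪o ι'` of the active spin orbitals with a frozen environment configuration `K ⊆ ι'`
(`Disjoint K (rangeF e)`; the environment orbitals outside `K` are empty):

* `embOne e`, `embTwo e` — the `0/1` embedding matrices of active spin orbitals / active pairs;
  `mixedPair e m` — the signed `0/±1` matrix sending an active orbital `i` to the pair `(e i, m)` minus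
  the pair `(m, e i)`;
* `frozenOne e K γ = E γ Eᴴ + ¹D(|K⟩)` and
  `frozenTwo e K γ Γ = E₂ Γ E₂ᴴ + Σ_{k ∈ K} F_k γ F_kᴴ + ²D(|K⟩)` — the EXTENDED PAIR; its entries are
  exactly the blocks of `FrozenCoreDensityMatrices.lean` with `¹D(ψ) ↦ γ`, `²D(ψ) ↦ Γ`, `⟨ψ,ψ⟩ ↦ 1`
  (the entries of the three pieces are computed here pattern by pattern — active / environment index
  in each slot; the blocks of the sums in `FrozenCoreRelaxationBlocks.lean`);
* **`posSemidef_frozenTwo`** — THE `D`-CONDITION TRANSPORTS: `Γ ⪰ 0 ∧ γ ⪰ 0 ⇒ frozenTwo e K γ Γ ⪰ 0`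
  (three congruences of positive semidefinite matrices; `γ ⪰ 0` holds on the DQG-feasible set by
  `IsDQGFeasible.one_posSemidef`), and `isHermitian_frozenOne`.

The block entries of `frozenOne` / `frozenTwo`, the `Q`- and `G`-conditions, the linear rows and the
energy identity against the frozen-core Hamiltonian follow in the sibling `FrozenCoreRelaxation*.lean`
files; together: `E_PQG(full basis; a + |C|, b + |C|) ≤ E_PQG(frozen-core reduction; a, b)` — the
relaxation-level twin of `sectorGroundEnergy_le_frozenCore`. References: D. A. Mazziotti, Adv. Chem.
Phys. 134 (2007) ch. 3 §II.B eqs. (11)–(17) [Mazziotti2007RDMChapter]; T. Helgaker, P. Jørgensen, J.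
Olsen, *Molecular Electronic-Structure Theory* (2000) §12.5.1, (1.7.17), (1.7.33)
[HelgakerJorgensenOlsen2000]. Nearest printed discussion of active-space 2-positivity: G. Gidofalvi,
D. A. Mazziotti, J. Chem. Phys. 129 (2008) 134108 (not held by the cell; nothing here is taken from it).
-/

noncomputable section

namespace Summit.Ventures.CertifiedQuantumChemistry

open Matrix Finset
open Literature.MathematicalPhysics.QuantumLattice Literature.MathematicalPhysics.QuantumChemistry JWEmbed
open scoped ComplexOrder

variable {ι ι' : Type*} [LinearOrder ι] [LinearOrder ι'] [Fintype ι] [Fintype ι']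
variable (e : ι ↪o ι') {K : Finset ι'}

/-! ## Index bookkeeping -/

omit [Fintype ι'] in
/-- An environment orbital is not an active orbital (simp form, environment index on the left). -/
theorem env_eq_apply_iff {m : ι'} (hm : m ∉ rangeF e) (i : ι) : m = e i ↔ False :=
  iff_false_intro fun h => hm (mem_rangeF.2 ⟨i, h.symm⟩)

omit [Fintype ι'] in
/-- An environment orbital is not an active orbital (simp form, environment index on the right). -/
theorem apply_eq_env_iff {m : ι'} (hm : m ∉ rangeF e) (i : ι) : e i = m ↔ False :=
  iff_false_intro fun h => hm (mem_rangeF.2 ⟨i, h⟩)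

omit [Fintype ι'] in
/-- An active orbital is not a frozen one (simp form). -/
theorem apply_mem_iff (hK : Disjoint K (rangeF e)) (i : ι) : e i ∈ K ↔ False :=
  iff_false_intro fun h => Finset.disjoint_left.1 hK h (mem_rangeF.2 ⟨i, rfl⟩)

omit [Fintype ι'] in
/-- A frozen orbital is an environment orbital. -/
theorem not_mem_rangeF_of_mem (hK : Disjoint K (rangeF e)) {k : ι'} (hk : k ∈ K) : k ∉ rangeF e :=
  Finset.disjoint_left.1 hK hk

/-! ## The embedding matrices -/

/-- The `0/1` EMBEDDING MATRIX of the active spin orbitals, `E_{p i} = [p = e i]`. -/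
def embOne (e : ι ↪o ι') : Matrix ι' ι ℂ := Matrix.of fun p i => if p = e i then 1 else 0

/-- The `0/1` EMBEDDING MATRIX of active PAIRS, `E₂_{(p,q),(i,j)} = [p = e i][q = e j]`. -/
def embTwo (e : ι ↪o ι') : Matrix (ι' × ι') (ι × ι) ℂ :=
  Matrix.of fun p r => if p.1 = e r.1 ∧ p.2 = e r.2 then 1 else 0

/-- The signed MIXED-PAIR MATRIX of an environment orbital `m`: the active orbital `i` is sent to the
pair `(e i, m)` with sign `+` and to the pair `(m, e i)` with sign `−` (fermionic antisymmetry),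
`F_m_{(p,q), i} = [p = e i][q = m] − [p = m][q = e i]`. -/
def mixedPair (e : ι ↪o ι') (m : ι') : Matrix (ι' × ι') ι ℂ :=
  Matrix.of fun p i => (if p.1 = e i ∧ p.2 = m then 1 else 0) - (if p.1 = m ∧ p.2 = e i then 1 else 0)

omit [Fintype ι] [Fintype ι'] in
/-- Entries of `embOne`. -/
@[simp] theorem embOne_apply (p : ι') (i : ι) : embOne e p i = if p = e i then 1 else 0 := rfl

omit [Fintype ι] [Fintype ι'] in
/-- Entries of `(embOne e)ᴴ` (the matrix is real). -/
@[simp] theorem embOne_conjTranspose_apply (i : ι) (p : ι') :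
    (embOne e)ᴴ i p = if p = e i then 1 else 0 := by
  rw [conjTranspose_apply, embOne_apply]
  split_ifs <;> simp

omit [Fintype ι] [Fintype ι'] in
/-- Entries of `embTwo`. -/
@[simp] theorem embTwo_apply (p : ι' × ι') (r : ι × ι) :
    embTwo e p r = if p.1 = e r.1 ∧ p.2 = e r.2 then 1 else 0 := rfl

omit [Fintype ι] [Fintype ι'] in
/-- Entries of `(embTwo e)ᴴ` (the matrix is real). -/
@[simp] theorem embTwo_conjTranspose_apply (r : ι × ι) (p : ι' × ι') :
    (embTwo e)ᴴ r p = if p.1 = e r.1 ∧ p.2 = e r.2 then 1 else 0 := by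
  rw [conjTranspose_apply, embTwo_apply]
  split_ifs <;> simp

omit [Fintype ι] [Fintype ι'] in
/-- Entries of `mixedPair`. -/
@[simp] theorem mixedPair_apply (m : ι') (p : ι' × ι') (i : ι) :
    mixedPair e m p i =
      (if p.1 = e i ∧ p.2 = m then 1 else 0) - (if p.1 = m ∧ p.2 = e i then 1 else 0) := rfl

omit [Fintype ι] [Fintype ι'] in
/-- Entries of `(mixedPair e m)ᴴ` (the matrix is real). -/
@[simp] theorem mixedPair_conjTranspose_apply (m : ι') (i : ι) (p : ι' × ι') :
    (mixedPair e m)ᴴ i p =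
      (if p.1 = e i ∧ p.2 = m then 1 else 0) - (if p.1 = m ∧ p.2 = e i then 1 else 0) := by
  rw [conjTranspose_apply, mixedPair_apply]
  split_ifs <;> simp

/-! ## The extended pair -/

/-- **The frozen-core extension of a one-matrix**: `γ' = E γ Eᴴ + ¹D(|K⟩)` — the active block is `γ`,
the frozen orbitals carry occupation one, everything else vanishes (HJO (1.7.17), §12.5.1). -/
def frozenOne (e : ι ↪o ι') (K : Finset ι') (γ : Matrix ι ι ℂ) : Matrix ι' ι' ℂ :=
  embOne e * γ * (embOne e)ᴴ + oneRDM (Pi.single K (1 : ℂ))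

/-- **The frozen-core extension of a pair** `(γ, Γ)`: `Γ' = E₂ Γ E₂ᴴ + Σ_{k ∈ K} F_k γ F_kᴴ + ²D(|K⟩)` —
the all-active block is `Γ`, the active–core Coulomb / exchange blocks are `±[k = k' ∈ K] γ_ij`, the
core block is the two-matrix of the occupation vector `|K⟩` (HJO (1.7.33)), everything else vanishes. -/
def frozenTwo (e : ι ↪o ι') (K : Finset ι') (γ : Matrix ι ι ℂ) (Γ : Matrix (ι × ι) (ι × ι) ℂ) :
    Matrix (ι' × ι') (ι' × ι') ℂ :=
  embTwo e * Γ * (embTwo e)ᴴ + ∑ k ∈ K, mixedPair e k * γ * (mixedPair e k)ᴴ +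
    twoRDM (Pi.single K (1 : ℂ))

/-! ## Entries of the congruence pieces -/

section Pieces

variable (γ : Matrix ι ι ℂ) (Γ : Matrix (ι × ι) (ι × ι) ℂ)

omit [Fintype ι'] in
/-- Active block of `E γ Eᴴ`. -/
theorem embOne_mul_mul_apply_apply (i j : ι) : (embOne e * γ * (embOne e)ᴴ) (e i) (e j) = γ i j := by
  simp only [Matrix.mul_apply, embOne_apply, embOne_conjTranspose_apply, OrderEmbedding.eq_iff_eq,
    ite_mul, one_mul, zero_mul, mul_ite, mul_one, mul_zero, Finset.sum_ite_eq, Finset.mem_univ,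
    if_true]

omit [Fintype ι'] in
/-- `E γ Eᴴ` vanishes on an environment row. -/
theorem embOne_mul_mul_env_left {m : ι'} (hm : m ∉ rangeF e) (q : ι') :
    (embOne e * γ * (embOne e)ᴴ) m q = 0 := by
  simp only [Matrix.mul_apply, embOne_apply, env_eq_apply_iff e hm, if_false, zero_mul,
    Finset.sum_const_zero]

omit [Fintype ι'] in
/-- `E γ Eᴴ` vanishes on an environment column. -/
theorem embOne_mul_mul_env_right {m : ι'} (hm : m ∉ rangeF e) (p : ι') :
    (embOne e * γ * (embOne e)ᴴ) p m = 0 := by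
  simp only [Matrix.mul_apply, embOne_conjTranspose_apply, env_eq_apply_iff e hm, if_false, mul_zero,
    Finset.sum_const_zero]

omit [Fintype ι'] in
/-- All-active block of `E₂ Γ E₂ᴴ`. -/
theorem embTwo_mul_mul_active (i k j l : ι) :
    (embTwo e * Γ * (embTwo e)ᴴ) (e i, e k) (e j, e l) = Γ (i, k) (j, l) := by
  simp only [Matrix.mul_apply, embTwo_apply, embTwo_conjTranspose_apply, OrderEmbedding.eq_iff_eq,
    ite_mul, one_mul, zero_mul, mul_ite, mul_one, mul_zero, Fintype.sum_prod_type, ite_and,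
    Finset.sum_ite_irrel, Finset.sum_ite_eq, Finset.mem_univ, if_true, Finset.sum_const_zero]

omit [Fintype ι'] in
/-- `E₂ Γ E₂ᴴ` vanishes when the first row index is an environment orbital. -/
theorem embTwo_mul_mul_env_fst {m : ι'} (hm : m ∉ rangeF e) (p' : ι') (q : ι' × ι') :
    (embTwo e * Γ * (embTwo e)ᴴ) (m, p') q = 0 := by
  simp only [Matrix.mul_apply, embTwo_apply, env_eq_apply_iff e hm, false_and, if_false, zero_mul,
    Finset.sum_const_zero]

omit [Fintype ι'] in
/-- `E₂ Γ E₂ᴴ` vanishes when the second row index is an environment orbital. -/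
theorem embTwo_mul_mul_env_snd {m : ι'} (hm : m ∉ rangeF e) (p' : ι') (q : ι' × ι') :
    (embTwo e * Γ * (embTwo e)ᴴ) (p', m) q = 0 := by
  simp only [Matrix.mul_apply, embTwo_apply, env_eq_apply_iff e hm, and_false, if_false, zero_mul,
    Finset.sum_const_zero]

omit [Fintype ι'] in
/-- `E₂ Γ E₂ᴴ` vanishes when the first column index is an environment orbital. -/
theorem embTwo_mul_mul_env_fst' {m : ι'} (hm : m ∉ rangeF e) (p : ι' × ι') (q' : ι') :
    (embTwo e * Γ * (embTwo e)ᴴ) p (m, q') = 0 := by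
  simp only [Matrix.mul_apply, embTwo_conjTranspose_apply, env_eq_apply_iff e hm, false_and, if_false,
    mul_zero, Finset.sum_const_zero]

omit [Fintype ι'] in
/-- `E₂ Γ E₂ᴴ` vanishes when the second column index is an environment orbital. -/
theorem embTwo_mul_mul_env_snd' {m : ι'} (hm : m ∉ rangeF e) (p : ι' × ι') (q' : ι') :
    (embTwo e * Γ * (embTwo e)ᴴ) p (q', m) = 0 := by
  simp only [Matrix.mul_apply, embTwo_conjTranspose_apply, env_eq_apply_iff e hm, and_false, if_false,
    mul_zero, Finset.sum_const_zero]

omit [Fintype ι'] in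
/-- One term `F_k γ F_kᴴ` of the mixed-pair sum at general indices: an explicit double Kronecker form. -/
theorem mixedPair_mul_mul_apply (k : ι') (p q : ι' × ι') :
    (mixedPair e k * γ * (mixedPair e k)ᴴ) p q =
      ∑ i, ∑ j,
        ((if p.1 = e i ∧ p.2 = k then 1 else 0) - (if p.1 = k ∧ p.2 = e i then 1 else 0)) * γ i j *
          ((if q.1 = e j ∧ q.2 = k then 1 else 0) - (if q.1 = k ∧ q.2 = e j then 1 else 0)) := by
  simp only [Matrix.mul_apply, mixedPair_apply, mixedPair_conjTranspose_apply, Finset.sum_mul]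
  exact Finset.sum_comm

omit [Fintype ι'] in
/-- `F_k γ F_kᴴ` (`k` an environment orbital) vanishes on an all-active row. -/
theorem mixedPair_mul_mul_active_row {k : ι'} (hk : k ∉ rangeF e) (i l : ι) (q : ι' × ι') :
    (mixedPair e k * γ * (mixedPair e k)ᴴ) (e i, e l) q = 0 := by
  simp only [Matrix.mul_apply, mixedPair_apply, apply_eq_env_iff e hk, and_false, false_and, if_false,
    sub_self, zero_mul, Finset.sum_const_zero]

omit [Fintype ι'] in
/-- `F_k γ F_kᴴ` (`k` an environment orbital) vanishes on an all-active column. -/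
theorem mixedPair_mul_mul_active_col {k : ι'} (hk : k ∉ rangeF e) (p : ι' × ι') (j l : ι) :
    (mixedPair e k * γ * (mixedPair e k)ᴴ) p (e j, e l) = 0 := by
  simp only [Matrix.mul_apply, mixedPair_conjTranspose_apply, apply_eq_env_iff e hk, and_false,
    false_and, if_false, sub_self, mul_zero, Finset.sum_const_zero]

omit [Fintype ι'] in
/-- `F_k γ F_kᴴ` vanishes on an all-environment row. -/
theorem mixedPair_mul_mul_env_row (k : ι') {m m' : ι'} (hm : m ∉ rangeF e) (hm' : m' ∉ rangeF e)
    (q : ι' × ι') : (mixedPair e k * γ * (mixedPair e k)ᴴ) (m, m') q = 0 := by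
  simp only [Matrix.mul_apply, mixedPair_apply, env_eq_apply_iff e hm, env_eq_apply_iff e hm',
    and_false, false_and, if_false, sub_self, zero_mul, Finset.sum_const_zero]

omit [Fintype ι'] in
/-- `F_k γ F_kᴴ` vanishes on an all-environment column. -/
theorem mixedPair_mul_mul_env_col (k : ι') {m m' : ι'} (hm : m ∉ rangeF e) (hm' : m' ∉ rangeF e)
    (p : ι' × ι') : (mixedPair e k * γ * (mixedPair e k)ᴴ) p (m, m') = 0 := by
  simp only [Matrix.mul_apply, mixedPair_conjTranspose_apply, env_eq_apply_iff e hm,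
    env_eq_apply_iff e hm', and_false, false_and, if_false, sub_self, mul_zero, Finset.sum_const_zero]

omit [Fintype ι'] in
/-- Coulomb entry of one term: `(F_k γ F_kᴴ)_{(e i, m), (e j, m')} = [m = k][m' = k] γ_ij`. -/
theorem mixedPair_mul_mul_IEIE {k : ι'} (hk : k ∉ rangeF e) (i j : ι) (m m' : ι') :
    (mixedPair e k * γ * (mixedPair e k)ᴴ) (e i, m) (e j, m') =
      if m = k ∧ m' = k then γ i j else 0 := by
  rw [mixedPair_mul_mul_apply]
  simp only [OrderEmbedding.eq_iff_eq, apply_eq_env_iff e hk, false_and, if_false, sub_zero, ite_mul,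
    one_mul, zero_mul, mul_ite, mul_one, mul_zero, ite_and, Finset.sum_ite_irrel, Finset.sum_ite_eq,
    Finset.mem_univ, if_true, Finset.sum_const_zero]
  by_cases h1 : m = k <;> by_cases h2 : m' = k <;> simp [h1, h2]

omit [Fintype ι'] in
/-- Coulomb entry of one term: `(F_k γ F_kᴴ)_{(m, e i), (m', e j)} = [m = k][m' = k] γ_ij`. -/
theorem mixedPair_mul_mul_EIEI {k : ι'} (hk : k ∉ rangeF e) (i j : ι) (m m' : ι') :
    (mixedPair e k * γ * (mixedPair e k)ᴴ) (m, e i) (m', e j) =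
      if m = k ∧ m' = k then γ i j else 0 := by
  rw [mixedPair_mul_mul_apply]
  simp only [OrderEmbedding.eq_iff_eq, apply_eq_env_iff e hk, and_false, if_false, zero_sub, ite_mul,
    one_mul, zero_mul, mul_ite, mul_one, mul_zero, ite_and, neg_mul, mul_neg,
    Finset.sum_ite_irrel, Finset.sum_ite_eq, Finset.mem_univ, if_true, Finset.sum_const_zero,
    Finset.sum_neg_distrib]
  by_cases h1 : m = k <;> by_cases h2 : m' = k <;> simp [h1, h2]

omit [Fintype ι'] in
/-- Exchange entry of one term: `(F_k γ F_kᴴ)_{(e i, m), (m', e j)} = −[m = k][m' = k] γ_ij`. -/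
theorem mixedPair_mul_mul_IEEI {k : ι'} (hk : k ∉ rangeF e) (i j : ι) (m m' : ι') :
    (mixedPair e k * γ * (mixedPair e k)ᴴ) (e i, m) (m', e j) =
      if m = k ∧ m' = k then -γ i j else 0 := by
  rw [mixedPair_mul_mul_apply]
  simp only [OrderEmbedding.eq_iff_eq, apply_eq_env_iff e hk, false_and, and_false, if_false, sub_zero,
    zero_sub, ite_mul, one_mul, zero_mul, mul_ite, mul_one, mul_zero, ite_and, mul_neg,
    Finset.sum_ite_irrel, Finset.sum_ite_eq, Finset.mem_univ, if_true, Finset.sum_const_zero,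
    Finset.sum_neg_distrib]
  by_cases h1 : m = k <;> by_cases h2 : m' = k <;> simp [h1, h2]

omit [Fintype ι'] in
/-- Exchange entry of one term: `(F_k γ F_kᴴ)_{(m, e i), (e j, m')} = −[m = k][m' = k] γ_ij`. -/
theorem mixedPair_mul_mul_EIIE {k : ι'} (hk : k ∉ rangeF e) (i j : ι) (m m' : ι') :
    (mixedPair e k * γ * (mixedPair e k)ᴴ) (m, e i) (e j, m') =
      if m = k ∧ m' = k then -γ i j else 0 := by
  rw [mixedPair_mul_mul_apply]
  simp only [OrderEmbedding.eq_iff_eq, apply_eq_env_iff e hk, false_and, and_false, if_false, sub_zero,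
    zero_sub, ite_mul, one_mul, zero_mul, mul_ite, mul_one, mul_zero, ite_and, neg_mul,
    Finset.sum_ite_irrel, Finset.sum_ite_eq, Finset.mem_univ, if_true, Finset.sum_const_zero,
    Finset.sum_neg_distrib]
  by_cases h1 : m = k <;> by_cases h2 : m' = k <;> simp [h1, h2]

omit [Fintype ι'] in
/-- Summing the one-term Kronecker deltas over the frozen set. -/
theorem sum_ite_eq_and_eq (K : Finset ι') (m m' : ι') (x : ℂ) :
    (∑ k ∈ K, if m = k ∧ m' = k then x else 0) = if m = m' ∧ m' ∈ K then x else 0 := by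
  simp only [ite_and, Finset.sum_ite_eq]
  by_cases h : m = m'
  · subst h
    by_cases hK : m ∈ K <;> simp [hK]
  · simp [h, Ne.symm h]

omit [Fintype ι'] in
/-- `Σ_{k∈K} F_k γ F_kᴴ` vanishes on an all-active row. -/
theorem sum_mixedPair_mul_mul_active_row (hK : Disjoint K (rangeF e)) (i l : ι) (q : ι' × ι') :
    (∑ k ∈ K, mixedPair e k * γ * (mixedPair e k)ᴴ) (e i, e l) q = 0 := by
  rw [Matrix.sum_apply]
  exact Finset.sum_eq_zero fun k hk =>
    mixedPair_mul_mul_active_row e γ (not_mem_rangeF_of_mem e hK hk) i l q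

omit [Fintype ι'] in
/-- `Σ_{k∈K} F_k γ F_kᴴ` vanishes on an all-active column. -/
theorem sum_mixedPair_mul_mul_active_col (hK : Disjoint K (rangeF e)) (p : ι' × ι') (j l : ι) :
    (∑ k ∈ K, mixedPair e k * γ * (mixedPair e k)ᴴ) p (e j, e l) = 0 := by
  rw [Matrix.sum_apply]
  exact Finset.sum_eq_zero fun k hk =>
    mixedPair_mul_mul_active_col e γ (not_mem_rangeF_of_mem e hK hk) p j l

omit [Fintype ι'] in
/-- `Σ_{k∈K} F_k γ F_kᴴ` vanishes on an all-environment row. -/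
theorem sum_mixedPair_mul_mul_env_row (K : Finset ι') {m m' : ι'} (hm : m ∉ rangeF e)
    (hm' : m' ∉ rangeF e) (q : ι' × ι') :
    (∑ k ∈ K, mixedPair e k * γ * (mixedPair e k)ᴴ) (m, m') q = 0 := by
  rw [Matrix.sum_apply]
  exact Finset.sum_eq_zero fun k _ => mixedPair_mul_mul_env_row e γ k hm hm' q

omit [Fintype ι'] in
/-- `Σ_{k∈K} F_k γ F_kᴴ` vanishes on an all-environment column. -/
theorem sum_mixedPair_mul_mul_env_col (K : Finset ι') {m m' : ι'} (hm : m ∉ rangeF e)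
    (hm' : m' ∉ rangeF e) (p : ι' × ι') :
    (∑ k ∈ K, mixedPair e k * γ * (mixedPair e k)ᴴ) p (m, m') = 0 := by
  rw [Matrix.sum_apply]
  exact Finset.sum_eq_zero fun k _ => mixedPair_mul_mul_env_col e γ k hm hm' p

omit [Fintype ι'] in
/-- **Coulomb entry** of the mixed-pair sum: `((e i, m), (e j, m')) ↦ [m = m' ∈ K] γ_ij`. -/
theorem sum_mixedPair_mul_mul_IEIE (hK : Disjoint K (rangeF e)) (i j : ι) (m m' : ι') :
    (∑ k ∈ K, mixedPair e k * γ * (mixedPair e k)ᴴ) (e i, m) (e j, m') =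
      if m = m' ∧ m' ∈ K then γ i j else 0 := by
  rw [Matrix.sum_apply, ← sum_ite_eq_and_eq K m m' (γ i j)]
  exact Finset.sum_congr rfl fun k hk =>
    mixedPair_mul_mul_IEIE e γ (not_mem_rangeF_of_mem e hK hk) i j m m'

omit [Fintype ι'] in
/-- **Coulomb entry** of the mixed-pair sum: `((m, e i), (m', e j)) ↦ [m = m' ∈ K] γ_ij`. -/
theorem sum_mixedPair_mul_mul_EIEI (hK : Disjoint K (rangeF e)) (i j : ι) (m m' : ι') :
    (∑ k ∈ K, mixedPair e k * γ * (mixedPair e k)ᴴ) (m, e i) (m', e j) =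
      if m = m' ∧ m' ∈ K then γ i j else 0 := by
  rw [Matrix.sum_apply, ← sum_ite_eq_and_eq K m m' (γ i j)]
  exact Finset.sum_congr rfl fun k hk =>
    mixedPair_mul_mul_EIEI e γ (not_mem_rangeF_of_mem e hK hk) i j m m'

omit [Fintype ι'] in
/-- **Exchange entry** of the mixed-pair sum: `((e i, m), (m', e j)) ↦ −[m = m' ∈ K] γ_ij`. -/
theorem sum_mixedPair_mul_mul_IEEI (hK : Disjoint K (rangeF e)) (i j : ι) (m m' : ι') :
    (∑ k ∈ K, mixedPair e k * γ * (mixedPair e k)ᴴ) (e i, m) (m', e j) =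
      if m = m' ∧ m' ∈ K then -γ i j else 0 := by
  rw [Matrix.sum_apply, ← sum_ite_eq_and_eq K m m' (-γ i j)]
  exact Finset.sum_congr rfl fun k hk =>
    mixedPair_mul_mul_IEEI e γ (not_mem_rangeF_of_mem e hK hk) i j m m'

omit [Fintype ι'] in
/-- **Exchange entry** of the mixed-pair sum: `((m, e i), (e j, m')) ↦ −[m = m' ∈ K] γ_ij`. -/
theorem sum_mixedPair_mul_mul_EIIE (hK : Disjoint K (rangeF e)) (i j : ι) (m m' : ι') :
    (∑ k ∈ K, mixedPair e k * γ * (mixedPair e k)ᴴ) (m, e i) (e j, m') =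
      if m = m' ∧ m' ∈ K then -γ i j else 0 := by
  rw [Matrix.sum_apply, ← sum_ite_eq_and_eq K m m' (-γ i j)]
  exact Finset.sum_congr rfl fun k hk =>
    mixedPair_mul_mul_EIIE e γ (not_mem_rangeF_of_mem e hK hk) i j m m'

end Pieces

/-! ## Hermiticity and the `D`-condition of the extended pair -/

/-- The extended one-matrix of a Hermitian one-matrix is Hermitian. -/
theorem isHermitian_frozenOne {γ : Matrix ι ι ℂ} (hγ : γ.IsHermitian) : (frozenOne e K γ).IsHermitian :=
  (isHermitian_mul_mul_conjTranspose (embOne e) hγ).add (oneRDM_posSemidef _).isHermitian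

/-- The extended one-matrix of a positive semidefinite one-matrix is positive semidefinite. -/
theorem posSemidef_frozenOne {γ : Matrix ι ι ℂ} (hγ : γ.PosSemidef) : (frozenOne e K γ).PosSemidef :=
  (hγ.mul_mul_conjTranspose_same (embOne e)).add (oneRDM_posSemidef _)

/-- **THE `D`-CONDITION TRANSPORTS ALONG THE FROZEN-CORE EXTENSION**: if `γ ⪰ 0` and `Γ ⪰ 0` then
`frozenTwo e K γ Γ ⪰ 0` — the extension is a sum of congruences `E₂ Γ E₂ᴴ`, `F_k γ F_kᴴ` of positive
semidefinite matrices and of the two-matrix of the occupation vector `|K⟩` (`twoRDM_posSemidef`).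
On the DQG-feasible set `γ ⪰ 0` is automatic (`IsDQGFeasible.one_posSemidef`). -/
theorem posSemidef_frozenTwo {γ : Matrix ι ι ℂ} {Γ : Matrix (ι × ι) (ι × ι) ℂ} (hγ : γ.PosSemidef)
    (hΓ : Γ.PosSemidef) : (frozenTwo e K γ Γ).PosSemidef :=
  ((hΓ.mul_mul_conjTranspose_same (embTwo e)).add
    (posSemidef_sum K fun k _ => hγ.mul_mul_conjTranspose_same (mixedPair e k))).add (twoRDM_posSemidef _)

/-- The `D`-condition of the extension of a DQG-feasible pair. -/
theorem posSemidef_frozenTwo_of_isDQGFeasible {N : ℕ} {γ : Matrix ι ι ℂ} {Γ : Matrix (ι × ι) (ι × ι) ℂ}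
    (h : IsDQGFeasible N γ Γ) : (frozenTwo e K γ Γ).PosSemidef :=
  posSemidef_frozenTwo e h.one_posSemidef h.d_psd


end Summit.Ventures.CertifiedQuantumChemistry

end
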